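import Mathlib
import HarnessLib
import Summits.HubbardSuperconductivity.HubbardSuperconductivity.Theorems.KLProgrammeKLRegimeSplitSymInterpPureMoments

/-!
# K3 gen-8-FLOW (stmt 20437, stub (C), located risk «(C)-B-REP», sup route S-d): the symmetrised interpolant only sees the `B₂`-AVERAGE of its data
# — `symInterp L (f ∘ γ) = symInterp L f` for the site reflection, swap and inversion, hypothesis-free

Cell gate-hubbard-kl, seat p2 g14 (assembly `…EngineFrameShiftDressingSup`, generic layer 1).  c4a-1's generic aliasing-jet lemma
(`…C4aAliasingJetLemma.norm_iteratedFDeriv_evalM_symInterp_mul_trigPoly_le`, p575152) wants `D₄`-SYMMETRIC continuum data `g·P`; the door's lattice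
data `Re(g(p_k)·H(k))` carry an arbitrary two-leg kernel factor `H`.  No symmetry of the MODEL is needed: the interpolant `symInterp L f` reads `f` only
through `f_c(x)·h_{|x̃₀|,|x̃₁|}` (`eval_symInterp`), and both the cosine coefficients and the harmonics are blind to the hyperoctahedral group `B₂` acting on
the sites.  Here (pure lattice Fourier analysis, every `f`):

* §1 `torusCosCoeff_comp_reflect/_swap/_neg` — `(f∘ρ)_c(x) = f_c(ρx)` for `ρ ∈ {reflection (k₀,−k₁), swap (k₁,k₀), inversion −k}` (character duality
  `torusChar_reflect/_swap/_neg_right_eq_neg_left`);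
* §2 **`eval_symInterp_comp_reflect/_swap/_neg`** — `(symInterp L (f∘ρ)).eval p = (symInterp L f).eval p`; **`eval_symInterp_avg8`** — the interpolant of
  the eightfold `B₂`-average `f^{avg}` equals that of `f`;
* §3 `torusFourierInv_comp_reflect/_swap/_neg` — `𝔉⁻¹[f∘ρ] = 𝔉⁻¹[f]∘ρ` (the position-space coefficients transform alike), and the `B₂`-invariance of the
  position weight `(1+|x̃₀|+|x̃₁|)ʲ` (`siteWeight_reflect/_swap/_neg`);
* §4 lattice samples of a `2π`-periodic `D₄`-symmetric continuum symbol are `B₂`-invariant lattice data: `sample_comp_swap`, **`sample_comp_reflect`**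
  (uses the periodicity: `p_{−k₁} = 2π − p_{k₁}` or `0`), `sample_comp_neg`.

Proofs only; no definitions; nothing about the model is asserted.  References: BGM 2006 §2.3 (2.17) [cite: BenfattoGiulianiMastropietro2006];
Boyd 2001 §4.5 [cite: Boyd2001].
-/

noncomputable section

namespace Summit.HubbardSuperconductivity.HubbardSuperconductivity.Theorems.EngineV8

set_option linter.dupNamespace false -- summit = problem name (single-conjunct summit), D-0017

open Real Finset Literature.MathematicalPhysics.QuantumLattice Literature.Probability.LatticeModels
open Summit.HubbardSuperconductivity.HubbardSuperconductivity.Theorems.KLRegimeSplit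
open scoped ComplexConjugate

variable {L : ℕ} [NeZero L]

/-! ## §1 Cosine coefficients of `f ∘ ρ` -/

omit [NeZero L] in
/-- `![k 0, k 1] = k`. -/
theorem site_eta (k : TorusSite 2 L) : (![k 0, k 1] : TorusSite 2 L) = k := by
  ext i; fin_cases i <;> rfl

/-- `(f∘refl)_c(x) = f_c(refl x)`. -/
theorem torusCosCoeff_comp_reflect (f : TorusSite 2 L → ℝ) (x : TorusSite 2 L) :
    torusCosCoeff L (fun k => f ![k 0, -k 1]) x = torusCosCoeff L f ![x 0, -x 1] := by
  rw [torusCosCoeff_eq_re, torusCosCoeff_eq_re]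
  congr 2
  simp_rw [torusChar_reflect]
  exact Fintype.sum_equiv (siteReflect_involutive.toPerm _) _ _ fun k => by
    simp [Function.Involutive.coe_toPerm, site_eta]

/-- `(f∘swap)_c(x) = f_c(swap x)`. -/
theorem torusCosCoeff_comp_swap (f : TorusSite 2 L → ℝ) (x : TorusSite 2 L) :
    torusCosCoeff L (fun k => f ![k 1, k 0]) x = torusCosCoeff L f ![x 1, x 0] := by
  rw [torusCosCoeff_eq_re, torusCosCoeff_eq_re]
  congr 2
  simp_rw [torusChar_swap]
  exact Fintype.sum_equiv (siteSwap_involutive.toPerm _) _ _ fun k => by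
    simp [Function.Involutive.coe_toPerm, site_eta]

/-- `(f∘neg)_c(x) = f_c(−x)`. -/
theorem torusCosCoeff_comp_neg (f : TorusSite 2 L → ℝ) (x : TorusSite 2 L) :
    torusCosCoeff L (fun k => f (-k)) x = torusCosCoeff L f (-x) := by
  rw [torusCosCoeff_eq_re, torusCosCoeff_eq_re]
  congr 2
  simp_rw [torusChar_neg_right_eq_neg_left]
  exact Fintype.sum_equiv (Equiv.neg _) _ _ fun k => by simp

/-! ## §2 The interpolant of `f ∘ ρ` and of the `B₂`-average -/

/-- **`symInterp L (f∘refl) = symInterp L f`** (values). -/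
theorem eval_symInterp_comp_reflect (f : TorusSite 2 L → ℝ) (p : Fin 2 → ℝ) :
    (symInterp L (fun k => f ![k 0, -k 1])).eval p = (symInterp L f).eval p := by
  rw [eval_symInterp, eval_symInterp]
  simp_rw [torusCosCoeff_comp_reflect]
  refine Fintype.sum_equiv (siteReflect_involutive.toPerm _) _ _ fun x => ?_
  simp only [Function.Involutive.coe_toPerm, Matrix.cons_val_zero, Matrix.cons_val_one, ZMod.natAbs_valMinAbs_neg]

/-- **`symInterp L (f∘swap) = symInterp L f`** (values). -/
theorem eval_symInterp_comp_swap (f : TorusSite 2 L → ℝ) (p : Fin 2 → ℝ) :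
    (symInterp L (fun k => f ![k 1, k 0])).eval p = (symInterp L f).eval p := by
  rw [eval_symInterp, eval_symInterp]
  simp_rw [torusCosCoeff_comp_swap]
  refine Fintype.sum_equiv (siteSwap_involutive.toPerm _) _ _ fun x => ?_
  simp only [Function.Involutive.coe_toPerm, Matrix.cons_val_zero, Matrix.cons_val_one]
  rw [TrigPolyC4v.harmonic, TrigPolyC4v.harmonic]
  ring

/-- **`symInterp L (f∘neg) = symInterp L f`** (values). -/
theorem eval_symInterp_comp_neg (f : TorusSite 2 L → ℝ) (p : Fin 2 → ℝ) :
    (symInterp L (fun k => f (-k))).eval p = (symInterp L f).eval p := by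
  rw [eval_symInterp, eval_symInterp]
  simp_rw [torusCosCoeff_comp_neg]
  refine Fintype.sum_equiv (Equiv.neg _) _ _ fun x => ?_
  simp only [Equiv.neg_apply, Pi.neg_apply, ZMod.natAbs_valMinAbs_neg]

/-- **THE INTERPOLANT OF THE EIGHTFOLD `B₂`-AVERAGE IS THE INTERPOLANT** (values): with
`f^{avg}(k) = ⅛[f(k) + f(−k) + f(k₀,−k₁) + f(−k₀,k₁) + f(k₁,k₀) + f(−k₁,−k₀) + f(−k₁,k₀) + f(k₁,−k₀)]`,
`(symInterp L f^{avg}).eval p = (symInterp L f).eval p`. -/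
theorem eval_symInterp_avg8 (f : TorusSite 2 L → ℝ) (p : Fin 2 → ℝ) :
    (symInterp L (fun k => (f k + f (-k) + f ![k 0, -k 1] + f ![-k 0, k 1] + f ![k 1, k 0] + f ![-k 1, -k 0] +
        f ![-k 1, k 0] + f ![k 1, -k 0]) / 8)).eval p = (symInterp L f).eval p := by
  have e1 : (symInterp L (fun k => f (-k))).eval p = (symInterp L f).eval p := eval_symInterp_comp_neg f p
  have e2 : (symInterp L (fun k => f ![k 0, -k 1])).eval p = (symInterp L f).eval p := eval_symInterp_comp_reflect f p
  have e3 : (symInterp L (fun k => f ![-k 0, k 1])).eval p = (symInterp L f).eval p := by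
    have h := eval_symInterp_comp_neg (fun k => f ![k 0, -k 1]) p
    simp only [Pi.neg_apply, neg_neg] at h
    rw [h, e2]
  have e4 : (symInterp L (fun k => f ![k 1, k 0])).eval p = (symInterp L f).eval p := eval_symInterp_comp_swap f p
  have e5 : (symInterp L (fun k => f ![-k 1, -k 0])).eval p = (symInterp L f).eval p := by
    have h := eval_symInterp_comp_neg (fun k => f ![k 1, k 0]) p
    simp only [Pi.neg_apply] at h
    rw [h, e4]
  have e6 : (symInterp L (fun k => f ![-k 1, k 0])).eval p = (symInterp L f).eval p := by
    have h := eval_symInterp_comp_reflect (fun k => f ![k 1, k 0]) p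
    simp only [Matrix.cons_val_one, Matrix.cons_val_zero] at h
    rw [h, e4]
  have e7 : (symInterp L (fun k => f ![k 1, -k 0])).eval p = (symInterp L f).eval p := by
    have h := eval_symInterp_comp_reflect (fun k => f ![-k 1, -k 0]) p
    simp only [Matrix.cons_val_one, Matrix.cons_val_zero, neg_neg] at h
    rw [h, e5]
  have hsplit : (fun k => (f k + f (-k) + f ![k 0, -k 1] + f ![-k 0, k 1] + f ![k 1, k 0] + f ![-k 1, -k 0] +
        f ![-k 1, k 0] + f ![k 1, -k 0]) / 8) = fun k => (1 / 8 : ℝ) * (f k + f (-k) + f ![k 0, -k 1] + f ![-k 0, k 1] + f ![k 1, k 0] +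
          f ![-k 1, -k 0] + f ![-k 1, k 0] + f ![k 1, -k 0]) := by
    funext k; ring
  rw [hsplit, eval_symInterp_const_mul]
  rw [show (fun k => f k + f (-k) + f ![k 0, -k 1] + f ![-k 0, k 1] + f ![k 1, k 0] + f ![-k 1, -k 0] + f ![-k 1, k 0] + f ![k 1, -k 0]) =
      fun k => (((((((f k + f (-k)) + f ![k 0, -k 1]) + f ![-k 0, k 1]) + f ![k 1, k 0]) + f ![-k 1, -k 0]) + f ![-k 1, k 0]) + f ![k 1, -k 0])
      from rfl]
  rw [eval_symInterp_add L (fun k => f k + f (-k) + f ![k 0, -k 1] + f ![-k 0, k 1] + f ![k 1, k 0] + f ![-k 1, -k 0] + f ![-k 1, k 0])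
      (fun k => f ![k 1, -k 0]),
    eval_symInterp_add L (fun k => f k + f (-k) + f ![k 0, -k 1] + f ![-k 0, k 1] + f ![k 1, k 0] + f ![-k 1, -k 0]) (fun k => f ![-k 1, k 0]),
    eval_symInterp_add L (fun k => f k + f (-k) + f ![k 0, -k 1] + f ![-k 0, k 1] + f ![k 1, k 0]) (fun k => f ![-k 1, -k 0]),
    eval_symInterp_add L (fun k => f k + f (-k) + f ![k 0, -k 1] + f ![-k 0, k 1]) (fun k => f ![k 1, k 0]),
    eval_symInterp_add L (fun k => f k + f (-k) + f ![k 0, -k 1]) (fun k => f ![-k 0, k 1]),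
    eval_symInterp_add L (fun k => f k + f (-k)) (fun k => f ![k 0, -k 1]),
    eval_symInterp_add L f (fun k => f (-k)), e1, e2, e3, e4, e5, e6, e7]
  ring

/-! ## §3 Position-space coefficients of `f ∘ ρ` and the invariance of the position weight -/

/-- `𝔉⁻¹[f∘refl](x) = 𝔉⁻¹[f](refl x)`. -/
theorem torusFourierInv_comp_reflect (f : TorusSite 2 L → ℂ) (x : TorusSite 2 L) :
    torusFourierInv (fun k => f ![k 0, -k 1]) x = torusFourierInv f ![x 0, -x 1] := by
  rw [torusFourierInv_eq_sum_torusChar, torusFourierInv_eq_sum_torusChar]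
  congr 1
  simp_rw [torusChar_reflect]
  exact Fintype.sum_equiv (siteReflect_involutive.toPerm _) _ _ fun k => by
    simp [Function.Involutive.coe_toPerm, site_eta]

/-- `𝔉⁻¹[f∘swap](x) = 𝔉⁻¹[f](swap x)`. -/
theorem torusFourierInv_comp_swap (f : TorusSite 2 L → ℂ) (x : TorusSite 2 L) :
    torusFourierInv (fun k => f ![k 1, k 0]) x = torusFourierInv f ![x 1, x 0] := by
  rw [torusFourierInv_eq_sum_torusChar, torusFourierInv_eq_sum_torusChar]
  congr 1
  simp_rw [torusChar_swap]
  exact Fintype.sum_equiv (siteSwap_involutive.toPerm _) _ _ fun k => by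
    simp [Function.Involutive.coe_toPerm, site_eta]

/-- `𝔉⁻¹[f∘neg](x) = 𝔉⁻¹[f](−x)`. -/
theorem torusFourierInv_comp_neg (f : TorusSite 2 L → ℂ) (x : TorusSite 2 L) :
    torusFourierInv (fun k => f (-k)) x = torusFourierInv f (-x) := by
  rw [torusFourierInv_eq_sum_torusChar, torusFourierInv_eq_sum_torusChar]
  congr 1
  simp_rw [torusChar_neg_right_eq_neg_left]
  exact Fintype.sum_equiv (Equiv.neg _) _ _ fun k => by simp

omit [NeZero L] in
/-- The position weight `1 + |x̃₀| + |x̃₁|` is reflection-invariant. -/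
theorem siteWeight_reflect (x : TorusSite 2 L) :
    (1 + (((![x 0, -x 1] : TorusSite 2 L) 0).valMinAbs.natAbs : ℝ) + (((![x 0, -x 1] : TorusSite 2 L) 1).valMinAbs.natAbs : ℝ)) =
      1 + ((x 0).valMinAbs.natAbs : ℝ) + ((x 1).valMinAbs.natAbs : ℝ) := by
  simp only [Matrix.cons_val_zero, Matrix.cons_val_one, ZMod.natAbs_valMinAbs_neg]

omit [NeZero L] in
/-- The position weight is swap-invariant. -/
theorem siteWeight_swap (x : TorusSite 2 L) :
    (1 + (((![x 1, x 0] : TorusSite 2 L) 0).valMinAbs.natAbs : ℝ) + (((![x 1, x 0] : TorusSite 2 L) 1).valMinAbs.natAbs : ℝ)) =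
      1 + ((x 0).valMinAbs.natAbs : ℝ) + ((x 1).valMinAbs.natAbs : ℝ) := by
  simp only [Matrix.cons_val_zero, Matrix.cons_val_one]; ring

omit [NeZero L] in
/-- The position weight is inversion-invariant. -/
theorem siteWeight_neg (x : TorusSite 2 L) :
    (1 + (((-x : TorusSite 2 L) 0).valMinAbs.natAbs : ℝ) + (((-x : TorusSite 2 L) 1).valMinAbs.natAbs : ℝ)) =
      1 + ((x 0).valMinAbs.natAbs : ℝ) + ((x 1).valMinAbs.natAbs : ℝ) := by
  simp only [Pi.neg_apply, ZMod.natAbs_valMinAbs_neg]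

/-! ## §4 Lattice samples of a periodic `D₄`-symmetric continuum symbol are `B₂`-invariant -/

section Sample

variable {E : Type*} {g : Momentum → E}

omit [NeZero L] in
/-- Samples of a swap-symmetric symbol are swap-invariant. -/
theorem sample_comp_swap (hswap : ∀ p : Fin 2 → ℝ, g (WithLp.toLp 2 ![p 1, p 0]) = g (WithLp.toLp 2 p)) (k : TorusSite 2 L) :
    g (WithLp.toLp 2 (latticeMomentum L ![k 1, k 0])) = g (WithLp.toLp 2 (latticeMomentum L k)) := by
  have h : latticeMomentum L (![k 1, k 0] : TorusSite 2 L) = ![latticeMomentum L k 1, latticeMomentum L k 0] := by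
    funext i; fin_cases i <;> simp [latticeMomentum]
  rw [h, hswap]

/-- **Samples of a `2π`-periodic reflection-symmetric symbol are reflection-invariant** (`p_{−k₁} ∈ {2π − p_{k₁}, 0}`). -/
theorem sample_comp_reflect (hper : ∀ (j : Fin 2) (q : Momentum), g (q + EuclideanSpace.single j (2 * π)) = g q)
    (hrefl : ∀ p : Fin 2 → ℝ, g (WithLp.toLp 2 ![p 0, -p 1]) = g (WithLp.toLp 2 p)) (k : TorusSite 2 L) :
    g (WithLp.toLp 2 (latticeMomentum L ![k 0, -k 1])) = g (WithLp.toLp 2 (latticeMomentum L k)) := by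
  have hL : (L : ℝ) ≠ 0 := by exact_mod_cast NeZero.ne L
  by_cases hk : k 1 = 0
  · -- `p_{−0} = 0 = −p_0`
    have h : latticeMomentum L (![k 0, -k 1] : TorusSite 2 L) = ![latticeMomentum L k 0, -latticeMomentum L k 1] := by
      funext i; fin_cases i <;> simp [latticeMomentum, hk]
    rw [h, hrefl]
  · -- `p_{−k₁} = 2π − p_{k₁}`
    have hval : (((-k 1 : ZMod L).val : ℕ) : ℝ) = L - ((k 1).val : ℝ) := by
      rw [ZMod.neg_val, if_neg hk, Nat.cast_sub (ZMod.val_le _)]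
    have h : WithLp.toLp 2 (latticeMomentum L (![k 0, -k 1] : TorusSite 2 L)) =
        (WithLp.toLp 2 ![latticeMomentum L k 0, -latticeMomentum L k 1] : Momentum) + EuclideanSpace.single (1 : Fin 2) (2 * π) := by
      ext i
      fin_cases i
      · simp [latticeMomentum]
      · simp [latticeMomentum, hval]
        field_simp
        ring
    rw [h, hper, hrefl]

/-- Samples of a `2π`-periodic `D₄`-symmetric symbol are inversion-invariant (`−k = swap (refl (swap (refl k)))`). -/
theorem sample_comp_neg (hper : ∀ (j : Fin 2) (q : Momentum), g (q + EuclideanSpace.single j (2 * π)) = g q)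
    (hrefl : ∀ p : Fin 2 → ℝ, g (WithLp.toLp 2 ![p 0, -p 1]) = g (WithLp.toLp 2 p))
    (hswap : ∀ p : Fin 2 → ℝ, g (WithLp.toLp 2 ![p 1, p 0]) = g (WithLp.toLp 2 p)) (k : TorusSite 2 L) :
    g (WithLp.toLp 2 (latticeMomentum L (-k))) = g (WithLp.toLp 2 (latticeMomentum L k)) := by
  set k₁ : TorusSite 2 L := ![k 0, -k 1] with hk₁
  set k₂ : TorusSite 2 L := ![k₁ 1, k₁ 0] with hk₂
  set k₃ : TorusSite 2 L := ![k₂ 0, -k₂ 1] with hk₃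
  have hk : (-k : TorusSite 2 L) = ![k₃ 1, k₃ 0] := by
    ext i; fin_cases i <;> simp [hk₁, hk₂, hk₃]
  rw [hk, sample_comp_swap (L := L) hswap k₃, hk₃, sample_comp_reflect hper hrefl k₂, hk₂, sample_comp_swap (L := L) hswap k₁, hk₁,
    sample_comp_reflect hper hrefl k]

end Sample

end Summit.HubbardSuperconductivity.HubbardSuperconductivity.Theorems.EngineV8

end
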